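import Mathlib
import Summits.Ventures.HodgeRepro2.T5HeckeCorner

/-!
# `π^K = e_K · π^{K'}`: the corner `e_K H(G, K') e_K` acts on `π^{K'}` through `π^K`

Blind cell `pub-hodge-repro2`, seat p8 (gen 8), Tier-5 kernel support.  `T5HeckeCorner` (T5-57)
embeds `H(G, K)` into `H(G, K')` for `K' ≤ K` as the corner at the level idempotent `e_K`, and shows
that `e_K` acts on `V^{K'}` as the level projector of T5-35.  This file closes the corner-module
sentence of the Hecke dictionary (`T5CornerSimple`'s `cornerModule e M = e • M` with `M = π^{K'}`,
`e = e_K`):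

* `levelSub ρ K K'` — `V^K` as a subspace of `V^{K'}`; `range_heckeEnd_levelIdem` — the image of
  `e_K` acting on `V^{K'}` is exactly `V^K` (`π^K = e_K · π^{K'}`), and `e_K` is the identity on it;
* `isIdempotentElem_heckeEnd_levelIdem` — `e_K` acts as an idempotent operator;
* `heckeSMul_incl_apply` — for `T ∈ H(G, K)`, `incl T ∈ e_K H(G, K') e_K` acts on `w ∈ V^{K'}` by
  projecting to `e_K w ∈ V^K` and applying `T` there: the corner acts on `π^{K'}` through `π^K`, and
  on `π^K` as `H(G, K)`.

README §8(d): uses an L-value-free non-vanishing device: NO.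
-/

namespace Summit.Ventures.HodgeRepro2.T5HeckeCornerLevel

noncomputable section

open Summit.Ventures.HodgeRepro2.LevelPositivity
open Summit.Ventures.HodgeRepro2.T5LevelIdempotent
open Summit.Ventures.HodgeRepro2.T5HeckePermutationModule
open Summit.Ventures.HodgeRepro2.T5HeckeCorner
open MulAction

variable {G : Type*} [Group G] {k : Type*} [Field k] {V : Type*} [AddCommGroup V] [Module k V]
  (ρ : Representation k G V) (K K' : Subgroup G)

/-- `V^K` as a subspace of `V^{K'}` (for `K' ≤ K`, every `K`-fixed vector is `K'`-fixed). -/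
def levelSub : Submodule k (invariants ρ K') := (invariants ρ K).comap (invariants ρ K').subtype

/-- Membership in `levelSub`. -/
theorem mem_levelSub_iff {w : invariants ρ K'} : w ∈ levelSub ρ K K' ↔ (w : V) ∈ invariants ρ K :=
  Iff.rfl

variable (hle : K' ≤ K) [CharZero k] [Finite (orbit K ((1 : G) : G ⧸ K'))]

/-- `π^K = e_K · π^{K'}`: the image of the level idempotent `e_K ∈ H(G, K')` acting on `V^{K'}` is
`V^K`. -/
theorem range_heckeEnd_levelIdem (hK : KFinite ρ K) :
    LinearMap.range (heckeEnd ρ (levelIdem k K K' hle)) = levelSub ρ K K' := by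
  apply le_antisymm
  · rintro _ ⟨w, rfl⟩
    rw [mem_levelSub_iff, heckeEnd_apply, heckeSMul_levelIdem]
    haveI := hK w
    exact levelAverage_mem_invariants
  · intro w hw
    have hw' : (w : V) ∈ invariants ρ K := hw
    refine ⟨w, ?_⟩
    apply Subtype.ext
    rw [heckeEnd_apply, heckeSMul_levelIdem, levelAverage_of_mem_invariants hw']

/-- `e_K` is the identity on `V^K ⊆ V^{K'}`. -/
theorem heckeSMul_levelIdem_of_mem {w : invariants ρ K'} (hw : w ∈ levelSub ρ K K') :
    heckeSMul ρ (levelIdem k K K' hle) w = w := by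
  have hw' : (w : V) ∈ invariants ρ K := hw
  apply Subtype.ext
  rw [heckeSMul_levelIdem, levelAverage_of_mem_invariants hw']

/-- `e_K` acts on `V^{K'}` as an idempotent operator. -/
theorem isIdempotentElem_heckeEnd_levelIdem :
    IsIdempotentElem (heckeEnd ρ (levelIdem k K K' hle)) := by
  show heckeEnd ρ (levelIdem k K K' hle) * heckeEnd ρ (levelIdem k K K' hle) =
    heckeEnd ρ (levelIdem k K K' hle)
  ext w
  show (heckeSMul ρ (levelIdem k K K' hle) (heckeSMul ρ (levelIdem k K K' hle) w) : V) =
    (heckeSMul ρ (levelIdem k K K' hle) w : V)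
  rw [← heckeSMul_mul, (isIdempotentElem_levelIdem k K K' hle).eq]

omit [CharZero k] [Finite (orbit K ((1 : G) : G ⧸ K'))] in
/-- The projection `V^{K'} → V^K`, `w ↦ e_K w` (`ρ` `K`-finite). -/
def levelProj (hK : KFinite ρ K) (w : invariants ρ K') : invariants ρ K :=
  ⟨levelAverage ρ K w, by
    haveI := hK w
    exact levelAverage_mem_invariants⟩

omit [CharZero k] [Finite (orbit K ((1 : G) : G ⧸ K'))] in
/-- The value of `levelProj`. -/
@[simp] theorem levelProj_coe (hK : KFinite ρ K) (w : invariants ρ K') :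
    (levelProj ρ K K' hK w : V) = levelAverage ρ K w :=
  rfl

/-- `e_K w = levelProj w` inside `V^{K'}`. -/
theorem heckeSMul_levelIdem_eq_inclInv (hK : KFinite ρ K) (w : invariants ρ K') :
    heckeSMul ρ (levelIdem k K K' hle) w = inclInv ρ K K' hle (levelProj ρ K K' hK w) := by
  apply Subtype.ext
  rw [heckeSMul_levelIdem]
  rfl

/-- THE CORNER ACTS THROUGH `π^K`: for `T ∈ H(G, K)`, `incl T ∈ e_K H(G, K') e_K` acts on
`w ∈ V^{K'}` as `T` acts on the projection `e_K w ∈ V^K`. -/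
theorem heckeSMul_incl_apply (hK : KFinite ρ K) (T : heckeAlgebra k K) (w : invariants ρ K') :
    (heckeSMul ρ (incl k K K' hle T) w : V) = (heckeSMul ρ T (levelProj ρ K K' hK w) : V) := by
  rw [incl_eq_levelIdem_mul_mul k K K' hle T, heckeSMul_mul, heckeSMul_mul,
    heckeSMul_levelIdem_eq_inclInv ρ K K' hle hK w]
  have h1 : heckeSMul ρ (incl k K K' hle T) (inclInv ρ K K' hle (levelProj ρ K K' hK w)) =
      inclInv ρ K K' hle (heckeSMul ρ T (levelProj ρ K K' hK w)) :=
    Subtype.ext (heckeSMul_incl ρ K K' hle T _)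
  rw [h1, heckeSMul_levelIdem, levelAverage_of_mem_invariants]
  · rfl
  · exact (heckeSMul ρ T (levelProj ρ K K' hK w)).2

/-- `incl T` kills the complement of `V^K` in `V^{K'}`: `incl T • w = incl T • (e_K w)`. -/
theorem heckeSMul_incl_eq_heckeSMul_levelIdem (hK : KFinite ρ K) (T : heckeAlgebra k K)
    (w : invariants ρ K') :
    heckeSMul ρ (incl k K K' hle T) w =
      heckeSMul ρ (incl k K K' hle T) (heckeSMul ρ (levelIdem k K K' hle) w) := by
  apply Subtype.ext
  rw [heckeSMul_incl_apply ρ K K' hle hK, heckeSMul_incl_apply ρ K K' hle hK]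
  congr 2
  apply Subtype.ext
  rw [levelProj_coe, levelProj_coe, heckeSMul_levelIdem]
  haveI := hK w
  rw [levelAverage_of_mem_invariants levelAverage_mem_invariants]

end

end Summit.Ventures.HodgeRepro2.T5HeckeCornerLevel
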